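import Summits.BirchSwinnertonDyer.Rank1Residual.Additive.RamifiedSevenGenusKummerLayerFields
import Summits.BirchSwinnertonDyer.Rank1Residual.Additive.RamifiedSevenGenusFrameGaussSqrt
import Literature.NumberTheory.GaloisRepresentations.AbsGaloisEmbeddingTransport
import Literature.NumberTheory.EllipticCurves.CyclotomicZpExtensionLayerTorsionProofs
import HarnessLib

/-!
# `𝒞₇` genus road (crux `EllipticUnitValueSevenOfGZK`, K7r), row K2C-12 = (B2′) KUMMER NON-VANISHING, File A2a:
# THE LAYER GROUPS THROUGH THE TRANSPORT `c : Γ_K →* Γ_ℚ` OF `e : K̄ → ℚ̄` — `Gal(ℚ̄/F′ₙ) ≤ c(Γ_K)` under (A1),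
# quadratic residues `(a_σ|7) = 1`, `Hₙ = c⁻¹Gal(ℚ̄/F′ₙ)`, and (L1b) «fixed by `Hₙ` ⇒ `e z ∈ F′ₙ`»

Cell bsd-cm, seat bsd-cm-k-ty1 g32; pen START packet `bsd-cm-plan/g38/START-kty1-g32.md` §2 (L1b), ((A2)-lemma); rulings D1082
((A0) `hK : K.IsCyclotomic`, (A1) `(s : Kcm) (hs : s² = −7)` GO; (A2)/(U*) DERIVE).  Memo
`Cruxes/EllipticUnitValueSevenOfGZK/K2C12KummerNonvanishing_g31.md` §1 (m3)–(m4).  Setting: `K = Kcm ∋ s`, `s² = −7`,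
`[K:ℚ] = 2`; `e : K̄ →+* ℚ̄` ARBITRARY (the displayed identification of (S-B2′)); `c : Γ_K →* Γ_ℚ` ANY homomorphism with
`e (σ z) = c σ • e z` (exists: `GaloisRepresentations.exists_transportHom`, p813193), `Hₙ = layerFixing F e n`,
`Uₙ = (K_cyc.restrictOfFinrankEqTwo _ Kcm h2).layerSubgroup n` (`K_cyc` a cyclotomic `ℤ₇`-extension of `ℚ`, (A0)).
* §1 (A1): `exists_gauss_seven` (the tree's Gauss sum `G ∈ ℚ(μ₇)`, `G² = −7`, `g G = (a|7)G`), `apply_algebraMap_eq_or`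
  (`e(s) = ±G`), `transport_smul_apply_algebraMap` (`c(Γ_K)` fixes `e(K)`), `galFixing_layer_le_range` (`Gal(ℚ̄/F′ₙ) ≤ c(Γ_K)`,
  with the tree's `apply_algebraMap_mem_layer`: `e(K) ⊆ F′ₙ`), ★ `jacobiSym_eq_one_of_smul_eq_pow` (`σ ∈ Γ_K` acts on a primitive
  7th root of `K̄` by a SQUARE mod 7).
* §2 `mem_layerFixing_iff_mem_galFixing` (`Hₙ = c⁻¹Gal(ℚ̄/F′ₙ)`), ★★ (L1b) `apply_mem_layer_of_forall_smul_eq`, `map_layerFixing_eq`.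
(The (A0)/(A2) index lemmas are in the sequel `RamifiedSevenGenusKummerLayerIndex.lean`.)
HONEST LABEL: Galois bookkeeping; theorems only; no definition, no named fact, no instance, no sorry; nothing closes;
(B2′) NOT proved here; stmt-BirchSwinnertonDyer-19945 OPEN; BSD claimed for no curve.

## References
* K. Kato, Astérisque 295 (2004), §15.5 (p. 253), 15.14 (p. 264). [Kato2004Asterisque]
* L. C. Washington, *Introduction to Cyclotomic Fields* (1997), Thm. 2.5, Ch. 4 Lemma 4.7–4.8, §13.1. [Washington1997]
* K. Ireland, M. Rosen, *A Classical Introduction to Modern Number Theory* (1990), Ch. 6 §3 (g² = (−1)^{(p−1)/2}p). [IrelandRosen1990]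
* S. Lang, *Cyclotomic Fields I–II* (1990), Ch. 10 §1 (PDF p. 167, ω and ⟨a⟩). [Lang1990]
* J. Neukirch, *Algebraic Number Theory* (1999), Ch. IV §1. [NeukirchANT1999]
-/

noncomputable section

open scoped NumberField
open Field Polynomial
open Literature.NumberTheory.IwasawaTheory
open Literature.NumberTheory.GaloisRepresentations Literature.NumberTheory.GaloisRepresentations.LocalWeilDatum
open Literature.NumberTheory.EllipticCurves

namespace Summit.BirchSwinnertonDyer.Rank1Residual.Additive.GenusSeven

namespace GenusFrame

variable (F : GenusFrame) {Kcm : Type} [Field Kcm] [NumberField Kcm]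
  (e : AlgebraicClosure Kcm →+* AlgebraicClosure ℚ)

/-! ## §1 (A1): the Gauss sum, `c(Γ_K)` fixes `e(K) ⊆ F′ₙ`, quadratic residues -/

omit [NumberField Kcm] in
/-- **The quadratic Gauss sum at `7` in `ℚ̄`**: `G ∈ ℚ(μ₇)`, `G² = −7`, `G ≠ 0`, and every `g ∈ Γ_ℚ` acting on `μ₇` as the
`a`-th power acts on `G` by the Legendre symbol `(a|7)` (the tree's `ArithmeticInputs.exists_gaussSqrt_prime` at `q = 7`, `χ₄(7) = −1`).
[cite: IrelandRosen1990, Ch. 6 §3 (Prop. 6.3.2)] [cite: Washington1997, Ch. 4 Lemma 4.7–4.8] -/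
theorem exists_gauss_seven :
    ∃ G : AlgebraicClosure ℚ, G ∈ ArithmeticInputs.rootField 7 ∧ G ^ 2 = -7 ∧ G ≠ 0 ∧
      ∀ (g : absoluteGaloisGroup ℚ) (a : ℕ), (∀ ζ : AlgebraicClosure ℚ, ζ ^ 7 = 1 → g • ζ = ζ ^ a) →
        g • G = (jacobiSym a 7 : AlgebraicClosure ℚ) * G := by
  haveI : Fact (Nat.Prime 7) := ⟨Nat.prime_seven⟩
  obtain ⟨G, hGmem, hGsq, hG0, hGgal⟩ := ArithmeticInputs.exists_gaussSqrt_prime 7 (by norm_num)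
  refine ⟨G, hGmem, ?_, hG0, fun g a hg ↦ ?_⟩
  · rw [hGsq]
    have : (ZMod.χ₄ (7 : ℕ) : ℤ) = -1 := by decide
    rw [this]; push_cast; ring
  · exact hGgal (absoluteGaloisGroup.toAlgEquiv ℚ g) a fun ζ hζ ↦ hg ζ hζ

omit [NumberField Kcm] in
/-- `e(s) = ±G` (`e(s)² = −7 = G²` in the field `ℚ̄`). [cite: IrelandRosen1990, Ch. 6 §3] -/
theorem apply_algebraMap_eq_or {s : Kcm} (hs : s ^ 2 = -7) {G : AlgebraicClosure ℚ} (hG : G ^ 2 = -7) :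
    e (algebraMap Kcm (AlgebraicClosure Kcm) s) = G ∨ e (algebraMap Kcm (AlgebraicClosure Kcm) s) = -G := by
  apply sq_eq_sq_iff_eq_or_eq_neg.mp
  rw [hG, ← map_pow, ← map_pow, hs, map_neg, map_ofNat, map_neg, map_ofNat]

omit [NumberField Kcm] in
/-- Elements of `c(Γ_K)` fix `e(K)`: `c σ • e(k) = e(σ k) = e(k)`. [cite: NeukirchANT1999, Ch. IV §1] -/
theorem transport_smul_apply_algebraMap {c : absoluteGaloisGroup Kcm →* absoluteGaloisGroup ℚ}
    (hc : ∀ (σ : absoluteGaloisGroup Kcm) (z : AlgebraicClosure Kcm), e (σ • z) = c σ • e z)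
    (σ : absoluteGaloisGroup Kcm) (k : Kcm) :
    c σ • e (algebraMap Kcm (AlgebraicClosure Kcm) k) = e (algebraMap Kcm (AlgebraicClosure Kcm) k) := by
  rw [← hc, absoluteGaloisGroup.smul_def, AlgEquiv.commutes]

/-- **`Gal(ℚ̄/F′ₙ) ≤ c(Γ_K)`** under (A1): elements fixing `F′ₙ ⊇ e(K)` (`apply_algebraMap_mem_layer`, `K = ℚ(s)`, `e(s) = ±√−7 ∈ ℚ(μ₇)`)
come from `Γ_K` (range description of `exists_transportHom` (iv)). [cite: NeukirchANT1999, Ch. IV §1] [cite: Kato2004Asterisque, §15.14 (p. 264)] -/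
theorem galFixing_layer_le_range {c : absoluteGaloisGroup Kcm →* absoluteGaloisGroup ℚ} (h2 : Module.finrank ℚ Kcm = 2)
    {s : Kcm} (hs : s ^ 2 = -7)
    (hrange : ∀ g : absoluteGaloisGroup ℚ, g ∈ c.range ↔
      ∀ x : Kcm, g • e (algebraMap Kcm (AlgebraicClosure Kcm) x) = e (algebraMap Kcm (AlgebraicClosure Kcm) x))
    (n : ℕ) : galFixing ℚ (F.layer n) ≤ c.range := fun g hg ↦
  (hrange g).mpr fun x ↦ (mem_galFixing_iff ℚ).mp hg _ (GenusFrame.apply_algebraMap_mem_layer h2 hs e n x)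

omit [NumberField Kcm] in
/-- ★ **Quadratic residues**: under (A1), every `σ ∈ Γ_K` acts on a primitive 7th root of unity `ζ₇′ ∈ K̄` as `ζ₇′ ↦ ζ₇′^a`
with `(a|7) = 1` — `σ` fixes `s`, so `c σ` fixes `e(s) = ±G`, while `c σ • G = (a|7)G`, `G ≠ 0`. [cite: IrelandRosen1990, Ch. 6 §3]
[cite: Washington1997, Ch. 4 Lemma 4.7] -/
theorem jacobiSym_eq_one_of_smul_eq_pow {c : absoluteGaloisGroup Kcm →* absoluteGaloisGroup ℚ}
    (hc : ∀ (σ : absoluteGaloisGroup Kcm) (z : AlgebraicClosure Kcm), e (σ • z) = c σ • e z)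
    {s : Kcm} (hs : s ^ 2 = -7) {ζ' : AlgebraicClosure Kcm} (hζ' : IsPrimitiveRoot ζ' 7)
    {σ : absoluteGaloisGroup Kcm} {a : ℕ} (hσ : σ • ζ' = ζ' ^ a) : jacobiSym a 7 = 1 := by
  haveI : NeZero (7 : ℕ) := ⟨by norm_num⟩
  obtain ⟨G, -, hGsq, hG0, hGgal⟩ := exists_gauss_seven
  -- `c σ` acts on `μ₇ ⊂ ℚ̄` as the `a`-th power (`e ζ₇′` is a primitive 7th root of `ℚ̄`)
  have heζ : IsPrimitiveRoot (e ζ') 7 := hζ'.map_of_injective e.injective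
  have hcσ : c σ • e ζ' = e ζ' ^ a := by rw [← hc, hσ, map_pow]
  have h7 : ∀ ζ : AlgebraicClosure ℚ, ζ ^ 7 = 1 → c σ • ζ = ζ ^ a :=
    smul_eq_pow_of_smul_primitiveRoot heζ hcσ (dvd_refl 7)
  have hG := hGgal (c σ) a h7
  -- `c σ` fixes `e(s) = ±G`
  have hfix : c σ • G = G := by
    have h := transport_smul_apply_algebraMap e hc σ s
    rcases apply_algebraMap_eq_or e hs hGsq with h' | h'
    · rwa [h'] at h
    · rwa [h', smul_neg, neg_inj] at h
  rw [hfix] at hG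
  have h1 : (jacobiSym a 7 : AlgebraicClosure ℚ) = 1 := (mul_eq_right₀ hG0).mp hG.symm
  exact_mod_cast h1

/-! ## §2 `Hₙ = c⁻¹ Gal(ℚ̄/F′ₙ)` and (L1b) -/

/-- **`σ ∈ Hₙ ↔ c σ ∈ Gal(ℚ̄/F′ₙ)`** (`e` is a bijection). [cite: NeukirchANT1999, Ch. IV §1] -/
theorem mem_layerFixing_iff_mem_galFixing {c : absoluteGaloisGroup Kcm →* absoluteGaloisGroup ℚ}
    (hc : ∀ (σ : absoluteGaloisGroup Kcm) (z : AlgebraicClosure Kcm), e (σ • z) = c σ • e z)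
    (hbij : Function.Bijective e) (n : ℕ) (σ : absoluteGaloisGroup Kcm) :
    σ ∈ layerFixing F e n ↔ c σ ∈ galFixing ℚ (F.layer n) := by
  rw [F.mem_layerFixing_iff e n σ]
  exact forall_smul_eq_iff_mem_galFixing (e := e.toRatAlgHom) (c := c) hc hbij (F.layer n) σ

/-- ★★ **(L1b) an element of `K̄` fixed by `Hₙ` has `e`-image in `F′ₙ`** (under (A1): `Gal(ℚ̄/F′ₙ) ≤ c(Γ_K)`; Krull–Galois on the
`ℚ̄`-side through `c`, `GaloisRepresentations.apply_mem_of_forall_smul_eq`). [cite: NeukirchANT1999, Ch. IV §1 Thm. (1.2)]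
[cite: Kato2004Asterisque, §15.5 (p. 253)] -/
theorem apply_mem_layer_of_forall_smul_eq {c : absoluteGaloisGroup Kcm →* absoluteGaloisGroup ℚ}
    (hc : ∀ (σ : absoluteGaloisGroup Kcm) (z : AlgebraicClosure Kcm), e (σ • z) = c σ • e z)
    (hbij : Function.Bijective e) (h2 : Module.finrank ℚ Kcm = 2) {s : Kcm} (hs : s ^ 2 = -7)
    (hrange : ∀ g : absoluteGaloisGroup ℚ, g ∈ c.range ↔
      ∀ x : Kcm, g • e (algebraMap Kcm (AlgebraicClosure Kcm) x) = e (algebraMap Kcm (AlgebraicClosure Kcm) x))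
    (n : ℕ) {z : AlgebraicClosure Kcm} (hz : ∀ σ ∈ layerFixing F e n, σ • z = z) : e z ∈ F.layer n :=
  apply_mem_of_forall_smul_eq (e := e.toRatAlgHom) (c := c) hc (F.galFixing_layer_le_range e h2 hs hrange n)
    fun σ hσ ↦ hz σ ((F.mem_layerFixing_iff_mem_galFixing e hc hbij n σ).mpr hσ)

omit [NumberField Kcm] in
/-- Conversely (trivially) elements with `e z ∈ F′ₙ` are fixed by `Hₙ`. [cite: NeukirchANT1999, Ch. IV §1] -/
theorem smul_eq_of_apply_mem_layer (n : ℕ) {z : AlgebraicClosure Kcm} (hz : e z ∈ F.layer n) {σ : absoluteGaloisGroup Kcm}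
    (hσ : σ ∈ layerFixing F e n) : σ • z = z :=
  (F.mem_layerFixing_iff e n σ).mp hσ z hz

/-- **`c(Hₙ) = Gal(ℚ̄/F′ₙ)`** under (A1). [cite: NeukirchANT1999, Ch. IV §1] -/
theorem map_layerFixing_eq {c : absoluteGaloisGroup Kcm →* absoluteGaloisGroup ℚ}
    (hc : ∀ (σ : absoluteGaloisGroup Kcm) (z : AlgebraicClosure Kcm), e (σ • z) = c σ • e z)
    (hbij : Function.Bijective e) (h2 : Module.finrank ℚ Kcm = 2) {s : Kcm} (hs : s ^ 2 = -7)
    (hrange : ∀ g : absoluteGaloisGroup ℚ, g ∈ c.range ↔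
      ∀ x : Kcm, g • e (algebraMap Kcm (AlgebraicClosure Kcm) x) = e (algebraMap Kcm (AlgebraicClosure Kcm) x))
    (n : ℕ) : (layerFixing F e n).map c = galFixing ℚ (F.layer n) := by
  ext g
  constructor
  · rintro ⟨σ, hσ, rfl⟩
    exact (F.mem_layerFixing_iff_mem_galFixing e hc hbij n σ).mp hσ
  · intro hg
    obtain ⟨σ, rfl⟩ := F.galFixing_layer_le_range e h2 hs hrange n hg
    exact ⟨σ, (F.mem_layerFixing_iff_mem_galFixing e hc hbij n σ).mpr hg, rfl⟩

end GenusFrame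

end Summit.BirchSwinnertonDyer.Rank1Residual.Additive.GenusSeven

end
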